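import Summits.HodgeConjecture.HodgeConjecture.Theorems.Ring2WeilCoverageCMFieldRowsA
import Mathlib.NumberTheory.LegendreSymbol.QuadraticReciprocity
import Mathlib.Data.Fintype.Parity
import HarnessLib

/-!
# Weil-type components over quartic CM fields, IX (part A): ALL PRIMES — the classes `[ℓ]` of the rational
# primes in CONGRUENCE CLASSES (variable `ℓ`): residue tools, `ℚ(ζ₅)`, `ℚ(ζ₈)`

research route conditional on HC_CM; not a corollary; Q11.4-sentence-2 already refuted in dim ≥ 3. Cell
`pub-hodge-ring2`, seat `ring2-b03` (gen 51); kernel form of the INDEX SET of the Weil-type family-coverage census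
`HOME/WEIL-FAMILY-COVERAGE.md` §b03 (operator priority5 2026-08-22T11:46:08Z). For a quartic CM field `E = F(√σ)`,
`F = ℚ[S]/(R)`, `R = S² + pS + q` (Deligne's carriers `Deligne1982/WeilTypeCMDiscriminant`), the components `W8.E.δ` of
the `(E, 4)`-Weil locus at `g = 8` are indexed by `δ ∈ F^×/Nm_{E/F}(E^×)` (`cmNormResidueGroup R`; Deligne §4 (1),
Lemma 4.6; Landherr). Gens 46–50 decided the classes `[n]`, `1 ≤ n ≤ 40`, prime by prime (one `decide` per numeral).
This part IX replaces the numerals by a VARIABLE prime `ℓ` in a congruence class: the residue hypotheses of the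
generic criteria (`mk_prime_mul_ne_splitDiscriminantClassCM_of_no_root`, `…_of_two_roots`) are discharged for all
`ℓ` at once by quadratic reciprocity (Mathlib) and, where the obstruction is NOT a Legendre symbol of a rational
integer (the split primes of `ℚ(ζ₅)`; `ℚ(√-3,√5)` in part B), by reconstructing a primitive root of unity in `𝔽_ℓ`
from a square root of `σ` (§0: `x² = -3 ⇒ 3 ∣ ℓ - 1`; `x² = σ`, `R₅(σ) = 0 ⇒ 5 ∣ ℓ - 1`; `x² = √2 - 2 ⇒ 16 ∣ ℓ - 1`
when `√-2 ∈ 𝔽_ℓ`). Results (`ℓ ∤ w`):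

* `ℚ(ζ₅)` (`R = S² + 5S + 5`): `[ℓw] ≠ [1]` for EVERY prime `ℓ ≢ 0, 1 (mod 5)`, `ℓ ≠ 2` (inert `ℓ ≡ ±2`, split
  `ℓ ≡ 4 (mod 5)`) — Dirichlet density `3/4`; (`ℓ = 2`: gen 47, ramified descent);
* `ℚ(ζ₈)` (`R = S² + 6S + 1`): `[ℓw] ≠ [1]` for every prime `ℓ ≡ 7 (mod 8)`, and `[ℓ] = [1]` for every prime
  `ℓ ≢ 3 (mod 4)` (Fermat's two squares, Mathlib `Nat.Prime.sq_add_sq`).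

Parts B/C: `ℚ(ζ₁₂)`, `ℚ(√-3,√5)`, `ℚ(i,√5)`, `ℚ(√-(2+√2))`, `ℚ(√-(3+√2))`; part D: pairwise distinctness and, by
Dirichlet's theorem (Mathlib), INFINITELY MANY pairwise distinct non-split components for each of the seven fields.
No named fact, no definition, no `sorry`; nothing about the Hodge conjecture is asserted: the theorems decide the
index set of the census (Deligne Cor. 4.2 / Landherr), whose general member is OPEN on every row (census §b03.2).
References: [Deligne1982HodgeCycles] §4 p. 30 (1), Cor. 4.2, Lemma 4.6; [Landherr1936HermitianForms]. -/

noncomputable section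

set_option linter.dupNamespace false

open Polynomial

namespace Summit.HodgeConjecture.HodgeConjecture.Ring2.WeilCoverageCM

open Literature.AlgebraicGeometry.Deligne1982
open Literature.AlgebraicGeometry.HodgeTheory (splitDiscriminantClassCM)

/-! ### §0 Residue tools at a VARIABLE prime `ℓ` -/

section Residues

variable {ℓ : ℕ} [hℓ : Fact ℓ.Prime]

/-- A prime `m ≠ ℓ` is non-zero in `𝔽_ℓ`. [folklore] -/
theorem natCast_prime_ne_zero_zmod {m : ℕ} (hm : m.Prime) (h : ℓ ≠ m) : ((m : ℕ) : ZMod ℓ) ≠ 0 := by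
  rw [Ne, ZMod.natCast_eq_zero_iff]
  exact fun hd => h ((Nat.prime_dvd_prime_iff_eq hℓ.out hm).mp hd)

/-- `¬ IsSquare a` in the form `∀ r, r² ≠ a` used by the criteria. [folklore] -/
theorem forall_sq_ne_of_not_isSquare {M : Type*} [Monoid M] {a : M} (h : ¬ IsSquare a) : ∀ r : M, r ^ 2 ≠ a :=
  fun r hr => h ⟨r, by rw [← hr, sq]⟩

/-- **No root of `S² + pS + q` mod `ℓ` when `p² - 4q` is a non-square mod `ℓ`** (`(2k + p)² = p² - 4q` at a root `k`).
[folklore] -/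
theorem no_root_of_disc_not_isSquare (p q : ℤ) (hD : ¬ IsSquare ((p : ZMod ℓ) ^ 2 - 4 * (q : ZMod ℓ))) :
    ∀ k : ZMod ℓ, k ^ 2 + (p : ZMod ℓ) * k + (q : ZMod ℓ) ≠ 0 := fun k hk =>
  hD ⟨2 * k + p, by linear_combination (-4 : ZMod ℓ) * hk⟩

/-- **`x² = -3` in `𝔽_ℓ`, `ℓ ∉ {2, 3}`, forces `3 ∣ ℓ - 1`**: `ω = (x - 1)/2` satisfies `ω² + ω + 1 = 0`, so it is an
element of order `3` of `𝔽_ℓ^×` (Lagrange). [folklore] -/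
theorem three_dvd_sub_one_of_sq_eq_neg_three (h2 : ℓ ≠ 2) (h3 : ℓ ≠ 3) (x : ZMod ℓ) (hx : x ^ 2 = -3) :
    3 ∣ ℓ - 1 := by
  have h2' : (2 : ZMod ℓ) ≠ 0 := by exact_mod_cast natCast_prime_ne_zero_zmod Nat.prime_two h2
  have h3' : (3 : ZMod ℓ) ≠ 0 := by exact_mod_cast natCast_prime_ne_zero_zmod Nat.prime_three h3
  set ω : ZMod ℓ := (x - 1) / 2 with hω
  have h2ω : 2 * ω = x - 1 := by rw [hω]; field_simp
  have hquad : ω ^ 2 + ω + 1 = 0 := by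
    have h : (2 * ω) ^ 2 + 2 * (2 * ω) + 4 = 0 := by rw [h2ω]; linear_combination hx
    have h4 : (4 : ZMod ℓ) ≠ 0 := by rw [show (4 : ZMod ℓ) = 2 * 2 by norm_num]; exact mul_ne_zero h2' h2'
    have h' : (4 : ZMod ℓ) * (ω ^ 2 + ω + 1) = 0 := by linear_combination h
    exact (mul_eq_zero.mp h').resolve_left h4
  have hω3 : ω ^ 3 = 1 := by linear_combination (ω - 1) * hquad
  have hω1 : ω ≠ 1 := by
    intro h1; rw [h1] at hquad; exact h3' (by linear_combination hquad)
  have hω0 : ω ≠ 0 := by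
    intro h0; rw [h0] at hquad; exact one_ne_zero (by linear_combination hquad)
  haveI : Fact (Nat.Prime 3) := ⟨Nat.prime_three⟩
  have hord : orderOf ω = 3 := orderOf_eq_prime hω3 hω1
  exact hord ▸ orderOf_dvd_of_pow_eq_one (ZMod.pow_card_sub_one_eq_one hω0)

/-- **A square root in `𝔽_ℓ` of a root of `S² + 5S + 5` forces `5 ∣ ℓ - 1`** (`ℓ ∉ {2, 5}`). With `k² + 5k + 5 = 0`,
`x² = k`, put `c = -3 - k` (so `c² + c - 1 = 0`, `x² = c² - 4`) and `z = (c + x)/2`: then `z² - cz + 1 = 0`, hence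
`z⁵ = 1`, `z ≠ 1` — in `E = ℚ(ζ₅)`, `η = ζ₅ - ζ₅⁻¹` has `η² = σ`, and `ζ₅ = (c + η)/2` with `c = ζ₅ + ζ₅⁻¹`; the lemma is
this identity read in `𝔽_ℓ`: a prime `ℓ ∤ 10` with a place of `F = ℚ(√5)` of degree one that SPLITS in `E/F` is
`≡ 1 (mod 5)`. [folklore] -/
theorem five_dvd_sub_one_of_sq_eq_root (h2 : ℓ ≠ 2) (h5 : ℓ ≠ 5) (k x : ZMod ℓ)
    (hk : k ^ 2 + 5 * k + 5 = 0) (hx : x ^ 2 = k) : 5 ∣ ℓ - 1 := by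
  have h2' : (2 : ZMod ℓ) ≠ 0 := by exact_mod_cast natCast_prime_ne_zero_zmod Nat.prime_two h2
  have h5' : (5 : ZMod ℓ) ≠ 0 := by exact_mod_cast natCast_prime_ne_zero_zmod (by norm_num : Nat.Prime 5) h5
  set c : ZMod ℓ := -3 - k with hc
  have hcc : c ^ 2 + c - 1 = 0 := by rw [hc]; linear_combination hk
  have hxc : x ^ 2 = c ^ 2 - 4 := by rw [hc, hx]; linear_combination -hk
  set z : ZMod ℓ := (c + x) / 2 with hz
  have h2z : 2 * z = c + x := by rw [hz]; field_simp
  have hquad : z ^ 2 - c * z + 1 = 0 := by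
    have h : (2 * z) ^ 2 - 2 * c * (2 * z) + 4 = 0 := by rw [h2z]; linear_combination hxc
    have h4 : (4 : ZMod ℓ) ≠ 0 := by rw [show (4 : ZMod ℓ) = 2 * 2 by norm_num]; exact mul_ne_zero h2' h2'
    have h' : (4 : ZMod ℓ) * (z ^ 2 - c * z + 1) = 0 := by linear_combination h
    exact (mul_eq_zero.mp h').resolve_left h4
  have hz5 : z ^ 5 = 1 := by
    linear_combination (z - 1) * (z ^ 2 + (c + 1) * z + 1) * hquad + (z - 1) * z ^ 2 * hcc
  have hz1 : z ≠ 1 := by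
    intro h1
    rw [h1] at hquad
    have hc2 : c = 2 := by linear_combination -hquad
    rw [hc2] at hcc
    exact h5' (by linear_combination hcc)
  have hz0 : z ≠ 0 := by
    intro h0; rw [h0] at hquad; exact one_ne_zero (by linear_combination hquad)
  haveI : Fact (Nat.Prime 5) := ⟨by norm_num⟩
  have hord : orderOf z = 5 := orderOf_eq_prime hz5 hz1
  exact hord ▸ orderOf_dvd_of_pow_eq_one (ZMod.pow_card_sub_one_eq_one hz0)

/-- **A square root in `𝔽_ℓ` of `√2 - 2`, together with `√-2 ∈ 𝔽_ℓ`, forces `16 ∣ ℓ - 1`** (`ℓ ≠ 2`). With `r² = 2`,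
`s² = -2`, `x² = r - 2`, the element `z = (x² + s)/(2x)` has `2z² = r + s`, `2z⁴ = rs`, `z⁸ = -1`: order `16` in
`𝔽_ℓ^×` — in `ℚ(ζ₁₆) ⊃ E = ℚ(√-(2-√2))`: `ζ₁₆ - ζ₁₆⁻¹ = √(√2 - 2)`, `(ζ₁₆ - ζ₁₆⁻¹)(ζ₁₆ + ζ₁₆⁻¹) = √-2`, so
`ζ₁₆ = (x² + √-2)/(2x)`; the lemma is this identity read in `𝔽_ℓ`. [folklore] -/
theorem sixteen_dvd_sub_one_of_sq_eq_sqrt_two_sub_two (h2 : ℓ ≠ 2) (r s x : ZMod ℓ)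
    (hr : r ^ 2 = 2) (hs : s ^ 2 = -2) (hx : x ^ 2 = r - 2) : 16 ∣ ℓ - 1 := by
  have h2' : (2 : ZMod ℓ) ≠ 0 := by exact_mod_cast natCast_prime_ne_zero_zmod Nat.prime_two h2
  have hx0 : x ≠ 0 := by
    intro h0
    rw [h0] at hx
    have hr2 : r = 2 := by linear_combination -hx
    rw [hr2] at hr
    exact h2' (by linear_combination hr)
  set z : ZMod ℓ := (x ^ 2 + s) / (2 * x) with hz
  have h2z : 2 * x * z = x ^ 2 + s := by rw [hz]; field_simp
  have hz2 : 2 * z ^ 2 = r + s := by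
    have h : (2 * x * z) ^ 2 = (x ^ 2 + s) ^ 2 := by rw [h2z]
    have h' : 2 * x ^ 2 * (2 * z ^ 2 - (r + s)) = 0 := by
      linear_combination h + (x ^ 2 - r - 2) * hx - hr + hs
    have hx2 : 2 * x ^ 2 ≠ 0 := mul_ne_zero h2' (pow_ne_zero 2 hx0)
    exact sub_eq_zero.1 ((mul_eq_zero.1 h').resolve_left hx2)
  have hz4 : 2 * z ^ 4 = r * s := by
    have h : (2 * z ^ 2) ^ 2 = (r + s) ^ 2 := by rw [hz2]
    have h' : (2 : ZMod ℓ) * (2 * z ^ 4 - r * s) = 0 := by linear_combination h + hr + hs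
    exact sub_eq_zero.1 ((mul_eq_zero.1 h').resolve_left h2')
  have hz8 : z ^ 8 = -1 := by
    have h : (2 * z ^ 4) ^ 2 = (r * s) ^ 2 := by rw [hz4]
    have h4 : (4 : ZMod ℓ) ≠ 0 := by rw [show (4 : ZMod ℓ) = 2 * 2 by norm_num]; exact mul_ne_zero h2' h2'
    have h' : (4 : ZMod ℓ) * (z ^ 8 + 1) = 0 := by linear_combination h + s ^ 2 * hr + 2 * hs
    exact eq_neg_of_add_eq_zero_left ((mul_eq_zero.1 h').resolve_left h4)
  have hz0 : z ≠ 0 := by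
    intro h0
    rw [h0, zero_pow (by norm_num)] at hz8
    exact h2' (by linear_combination 2 * hz8)
  have hnot : ¬ z ^ 2 ^ 3 = 1 := by
    rw [show (2 : ℕ) ^ 3 = 8 by norm_num, hz8]
    intro h
    exact h2' (by linear_combination -h)
  have hfin : z ^ 2 ^ (3 + 1) = 1 := by
    rw [show (2 : ℕ) ^ (3 + 1) = 8 * 2 by norm_num, pow_mul, hz8]; norm_num
  have hord : orderOf z = 16 := by
    have := orderOf_eq_prime_pow hnot hfin
    rw [this]; norm_num
  exact hord ▸ orderOf_dvd_of_pow_eq_one (ZMod.pow_card_sub_one_eq_one hz0)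

/-- `5` is a NON-square mod a prime `ℓ ≡ ±2 (mod 5)`, `ℓ ≠ 2` (quadratic reciprocity with `5 ≡ 1 (mod 4)`: `(5/ℓ) = (ℓ/5)`).
[folklore] -/
theorem not_isSquare_five_of_mod_five (h2 : ℓ ≠ 2) (h5 : ℓ % 5 = 2 ∨ ℓ % 5 = 3) : ¬ IsSquare (5 : ZMod ℓ) := by
  -- the two residue facts first (closed terms, before any local `Fact` instance enters the `Decidable` instance)
  have hℓ5 : ¬ IsSquare ((ℓ : ℕ) : ZMod 5) := by
    rw [← ZMod.natCast_mod ℓ 5]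
    rcases h5 with h5 | h5 <;> rw [h5]
    · exact (by decide : ¬ IsSquare ((2 : ℕ) : ZMod 5))
    · exact (by decide : ¬ IsSquare ((3 : ℕ) : ZMod 5))
  haveI : Fact (Nat.Prime 5) := ⟨by norm_num⟩
  have key := ZMod.exists_sq_eq_prime_iff_of_mod_four_eq_one (p := 5) (q := ℓ) (by norm_num) h2
  intro h
  have h' : IsSquare ((5 : ℕ) : ZMod ℓ) := by exact_mod_cast h
  exact hℓ5 (key.2 h')

/-- `5` IS a square mod a prime `ℓ ≡ ±1 (mod 5)`, `ℓ ≠ 2` (`(5/ℓ) = (ℓ/5)`). [folklore] -/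
theorem isSquare_five_of_mod_five (h2 : ℓ ≠ 2) (h5 : ℓ % 5 = 1 ∨ ℓ % 5 = 4) : IsSquare (5 : ZMod ℓ) := by
  have hℓ5 : IsSquare ((ℓ : ℕ) : ZMod 5) := by
    rw [← ZMod.natCast_mod ℓ 5]
    rcases h5 with h5 | h5 <;> rw [h5]
    · exact (by decide : IsSquare ((1 : ℕ) : ZMod 5))
    · exact (by decide : IsSquare ((4 : ℕ) : ZMod 5))
  haveI : Fact (Nat.Prime 5) := ⟨by norm_num⟩
  have key := ZMod.exists_sq_eq_prime_iff_of_mod_four_eq_one (p := 5) (q := ℓ) (by norm_num) h2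
  have := key.1 hℓ5
  exact_mod_cast this

/-- `3` IS a square mod a prime `ℓ ≡ 11 (mod 12)` (`ℓ ≡ 3 (4)`, `3 ≡ 3 (4)`: `(3/ℓ) = -(ℓ/3) = -(2/3) = 1`). [folklore] -/
theorem isSquare_three_of_mod_twelve (h12 : ℓ % 12 = 11) : IsSquare (3 : ZMod ℓ) := by
  have hℓ3 : ¬ IsSquare ((ℓ : ℕ) : ZMod 3) := by
    rw [← ZMod.natCast_mod ℓ 3, show ℓ % 3 = 2 by omega]
    exact (by decide : ¬ IsSquare ((2 : ℕ) : ZMod 3))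
  haveI : Fact (Nat.Prime 3) := ⟨Nat.prime_three⟩
  have key := ZMod.exists_sq_eq_prime_iff_of_mod_four_eq_three (p := ℓ) (q := 3) (by omega) (by norm_num) (by omega)
  have := key.2 hℓ3
  exact_mod_cast this


/-- `x² ≠ -t²` for `t ≠ 0` when `-1` is a non-square mod `ℓ` (`ℓ ≡ 3 (mod 4)`). [folklore] -/
theorem forall_sq_ne_neg_sq (hm1 : ¬ IsSquare (-1 : ZMod ℓ)) (t : ZMod ℓ) (ht : t ≠ 0) :
    ∀ x : ZMod ℓ, x ^ 2 ≠ -t ^ 2 := by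
  intro x hx
  refine hm1 ⟨x / t, ?_⟩
  field_simp
  linear_combination -hx

/-- From `c·X = 0` with a non-zero numeral-like `c`: `X = 0`. [folklore] -/
theorem eq_zero_of_const_mul_eq_zero {c X : ZMod ℓ} (hc : c ≠ 0) (h : c * X = 0) : X = 0 :=
  (mul_eq_zero.1 h).resolve_left hc

end Residues

/-! ### §1 `E = ℚ(ζ₅)`: `R = S² + 5S + 5`, `F = ℚ(√5)`, `σ = -(5+√5)/2` — every prime `ℓ ≢ 0, 1 (mod 5)`, `ℓ ≠ 2` -/

section Zeta5

variable {R : Polynomial ℤ} (hR : R = X ^ 2 + C 5 * X + C 5) [Fact (Irreducible (realPolyQ R))]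
include hR

/-- **`[ℓw] ≠ [1]` for `E = ℚ(ζ₅)` and EVERY prime `ℓ ≡ ±2 (mod 5)`, `ℓ ≠ 2`, `ℓ ∤ w`**: `ℓ` is INERT in `F = ℚ(√5)`
(`5` a non-square mod `ℓ`, reciprocity) and `(ℓ)` is inert in `E/F` (`Nm σ = 5` a non-square), so the generic inert
criterion applies — the Weil-type components `W8.E.[ℓw]` (abelian eightfolds, `E`-signature `(2,2;2,2)`) are NON-SPLIT:
no `E`-Lagrangian member (Deligne Cor. 4.2). Covers the census rows `[3], [7], [13], [17], [23], [37], …` at once.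
[cite: Deligne1982HodgeCycles, §4 p. 30 (1) and Cor. 4.2] [cite: Landherr1936HermitianForms] -/
theorem zeta5_mk_prime_mul_ne_splitDiscriminantClassCM_of_inert (ℓ : ℕ) (hℓ : ℓ.Prime) (h2 : ℓ ≠ 2)
    (h5 : ℓ % 5 = 2 ∨ ℓ % 5 = 3) (w : ℤ) (hw : ¬ (ℓ : ℤ) ∣ w) (u : (realField R)ˣ)
    (hu : (u : realField R) = AdjoinRoot.of (realPolyQ R) (ℓ * w)) :
    (QuotientGroup.mk u : cmNormResidueGroup R) ≠ splitDiscriminantClassCM R 2 := by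
  haveI : Fact ℓ.Prime := ⟨hℓ⟩
  have hns : ¬ IsSquare (5 : ZMod ℓ) := not_isSquare_five_of_mod_five h2 h5
  refine mk_prime_mul_ne_splitDiscriminantClassCM_of_no_root hR (by norm_num) (by norm_num) disc_not_sq_five_five
    ℓ hℓ ?_ ?_ w hw u hu
  · refine no_root_of_disc_not_isSquare 5 5 ?_
    push_cast
    rw [show (5 : ZMod ℓ) ^ 2 - 4 * 5 = 5 by norm_num]
    exact hns
  · push_cast
    exact forall_sq_ne_of_not_isSquare hns

/-- **`[ℓw] ≠ [1]` for `E = ℚ(ζ₅)` and EVERY prime `ℓ ≡ 4 (mod 5)`, `ℓ ∤ w`**: `ℓ` SPLITS in `F = ℚ(√5)` (`5 = r²`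
mod `ℓ`; the two places `σ ↦ (±r - 5)/2`) and BOTH places are inert in `E/F` — a square root of either image of `σ`
would produce a primitive fifth root of unity in `𝔽_ℓ` (`five_dvd_sub_one_of_sq_eq_root`), i.e. `ℓ ≡ 1 (mod 5)`. So
the split criterion applies: `W8.E.[ℓw]` is NON-SPLIT (census rows `[19], [29], …`). This obstruction is not a
Legendre symbol of a rational integer (`E/ℚ` cyclic quartic: it is the quartic residue condition `ℓ^((ℓ-1)/…)`, here
read off `ℓ mod 5`). [cite: Deligne1982HodgeCycles, §4 p. 30 (1) and Cor. 4.2] [cite: Landherr1936HermitianForms] -/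
theorem zeta5_mk_prime_mul_ne_splitDiscriminantClassCM_of_split (ℓ : ℕ) (hℓ : ℓ.Prime) (h5 : ℓ % 5 = 4)
    (w : ℤ) (hw : ¬ (ℓ : ℤ) ∣ w) (u : (realField R)ˣ)
    (hu : (u : realField R) = AdjoinRoot.of (realPolyQ R) (ℓ * w)) :
    (QuotientGroup.mk u : cmNormResidueGroup R) ≠ splitDiscriminantClassCM R 2 := by
  haveI : Fact ℓ.Prime := ⟨hℓ⟩
  have h2 : ℓ ≠ 2 := by omega
  have hℓ5 : ℓ ≠ 5 := by omega
  have h2' : (2 : ZMod ℓ) ≠ 0 := by exact_mod_cast natCast_prime_ne_zero_zmod Nat.prime_two h2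
  have h5' : (5 : ZMod ℓ) ≠ 0 := by exact_mod_cast natCast_prime_ne_zero_zmod (by norm_num : Nat.Prime 5) hℓ5
  have h4 : (4 : ZMod ℓ) ≠ 0 := by rw [show (4 : ZMod ℓ) = 2 * 2 by norm_num]; exact mul_ne_zero h2' h2'
  obtain ⟨r, hr⟩ := isSquare_five_of_mod_five h2 (Or.inr h5)
  -- the two roots `(±r - 5)/2` of `R` mod `ℓ`
  have hroot : ∀ k : ZMod ℓ, (2 * k + 5) ^ 2 = 5 → k ^ 2 + 5 * k + 5 = 0 := fun k hk =>
    eq_zero_of_const_mul_eq_zero h4 (by linear_combination hk)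
  have hnosq : ∀ k : ZMod ℓ, k ^ 2 + 5 * k + 5 = 0 → ∀ x : ZMod ℓ, x ^ 2 ≠ k := by
    intro k hk x hx
    have := five_dvd_sub_one_of_sq_eq_root h2 hℓ5 k x hk hx
    omega
  set k₁ : ZMod ℓ := (r - 5) / 2 with hk₁
  set k₂ : ZMod ℓ := (-r - 5) / 2 with hk₂
  have e₁ : 2 * k₁ + 5 = r := by rw [hk₁]; field_simp; ring
  have e₂ : 2 * k₂ + 5 = -r := by rw [hk₂]; field_simp; ring
  have hk1 : k₁ ^ 2 + 5 * k₁ + 5 = 0 := hroot k₁ (by rw [e₁]; linear_combination -hr)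
  have hk2 : k₂ ^ 2 + 5 * k₂ + 5 = 0 := hroot k₂ (by rw [e₂]; linear_combination -hr)
  refine mk_prime_mul_ne_splitDiscriminantClassCM_of_two_roots hR (by norm_num) (by norm_num) disc_not_sq_five_five
    ℓ hℓ k₁ k₂ (by push_cast; exact hk1) (by push_cast; exact hk2) ?_ (hnosq k₁ hk1) (hnosq k₂ hk2) w hw u hu
  intro h
  have h' : 2 * k₁ + 5 = 2 * k₂ + 5 := by rw [h]
  rw [e₁, e₂] at h'
  have hr0 : r = 0 := eq_zero_of_const_mul_eq_zero h2' (by linear_combination h')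
  rw [hr0, mul_zero] at hr
  exact h5' hr

/-- **`[ℓw] ≠ [1]` for `E = ℚ(ζ₅)` and EVERY prime `ℓ ≢ 0, 1 (mod 5)`, `ℓ ≠ 2`, `ℓ ∤ w`** (the two cases together): a
set of primes of Dirichlet density `3/4`, each giving NON-SPLIT Weil-type components `W8.E.[ℓw]`. (The primes
`ℓ ≡ 1 (mod 5)` and `ℓ = 5` are norms from `E` — `[11] = [31] = [5] = [1]`, gen 49 — and `[2] ≠ [1]` by the ramified
descent of gen 47.) [cite: Deligne1982HodgeCycles, §4 p. 30 (1) and Cor. 4.2] [cite: Landherr1936HermitianForms] -/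
theorem zeta5_mk_prime_mul_ne_splitDiscriminantClassCM_of_mod_five (ℓ : ℕ) (hℓ : ℓ.Prime) (h2 : ℓ ≠ 2)
    (h5 : ℓ % 5 = 2 ∨ ℓ % 5 = 3 ∨ ℓ % 5 = 4) (w : ℤ) (hw : ¬ (ℓ : ℤ) ∣ w) (u : (realField R)ˣ)
    (hu : (u : realField R) = AdjoinRoot.of (realPolyQ R) (ℓ * w)) :
    (QuotientGroup.mk u : cmNormResidueGroup R) ≠ splitDiscriminantClassCM R 2 := by
  rcases h5 with h5 | h5 | h5
  · exact zeta5_mk_prime_mul_ne_splitDiscriminantClassCM_of_inert hR ℓ hℓ h2 (Or.inl h5) w hw u hu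
  · exact zeta5_mk_prime_mul_ne_splitDiscriminantClassCM_of_inert hR ℓ hℓ h2 (Or.inr h5) w hw u hu
  · exact zeta5_mk_prime_mul_ne_splitDiscriminantClassCM_of_split hR ℓ hℓ h5 w hw u hu

/-- **`[ℓ] ≠ [1]` for `E = ℚ(ζ₅)` and every prime `ℓ ≢ 0, 1 (mod 5)`, `ℓ ≠ 2`**: the row `W8.E.[ℓ]` of the census is
a non-split component. [cite: Deligne1982HodgeCycles, §4 p. 30 (1) and Cor. 4.2] -/
theorem zeta5_mk_prime_ne_splitDiscriminantClassCM_of_mod_five (ℓ : ℕ) (hℓ : ℓ.Prime) (h2 : ℓ ≠ 2)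
    (h5 : ℓ % 5 = 2 ∨ ℓ % 5 = 3 ∨ ℓ % 5 = 4) (u : (realField R)ˣ) (hu : (u : realField R) = ℓ) :
    (QuotientGroup.mk u : cmNormResidueGroup R) ≠ splitDiscriminantClassCM R 2 :=
  zeta5_mk_prime_mul_ne_splitDiscriminantClassCM_of_mod_five hR ℓ hℓ h2 h5 1 (by exact_mod_cast hℓ.not_dvd_one) u
    (by rw [hu, Int.cast_one, mul_one]; exact (map_natCast (AdjoinRoot.of (realPolyQ R)) ℓ).symm)

end Zeta5

/-! ### §2 `E = ℚ(ζ₈) = ℚ(i,√2)`: `R = S² + 6S + 1`, `F = ℚ(√2)`, `σ = -(1+√2)²` — every prime: non-split iff `ℓ ≡ 7 (mod 8)`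
(here: `⇐`, and `[ℓ] = [1]` for `ℓ ≢ 3 (mod 4)`; `ℓ ≡ 3 (mod 8)`: `[3] = [11] = [19] = [1]`, gen 49) -/

section Zeta8

variable {R : Polynomial ℤ} (hR : R = X ^ 2 + C 6 * X + C 1) [Fact (Irreducible (realPolyQ R))]
include hR

/-- **`[ℓw] ≠ [1]` for `E = ℚ(ζ₈)` and EVERY prime `ℓ ≡ 7 (mod 8)`, `ℓ ∤ w`**: `ℓ` SPLITS in `F = ℚ(√2)` (`2 = r²` mod `ℓ`,
Mathlib `ZMod.exists_sq_eq_two_iff`; the places `σ ↦ -3 ± 2r = -(r ∓ 1)²`) and both places are INERT in `E = F(i)`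
(`-1` a non-square mod `ℓ ≡ 3 (mod 4)`), so the split criterion applies: the Weil-type components `W8.E.[ℓw]` are
NON-SPLIT (census rows `[7], [23], [31], [47], …` at once). [cite: Deligne1982HodgeCycles, §4 p. 30 (1) and Cor. 4.2]
[cite: Landherr1936HermitianForms] -/
theorem zeta8_mk_prime_mul_ne_splitDiscriminantClassCM_of_mod_eight (ℓ : ℕ) (hℓ : ℓ.Prime) (h8 : ℓ % 8 = 7)
    (w : ℤ) (hw : ¬ (ℓ : ℤ) ∣ w) (u : (realField R)ˣ)
    (hu : (u : realField R) = AdjoinRoot.of (realPolyQ R) (ℓ * w)) :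
    (QuotientGroup.mk u : cmNormResidueGroup R) ≠ splitDiscriminantClassCM R 2 := by
  haveI : Fact ℓ.Prime := ⟨hℓ⟩
  have h2 : ℓ ≠ 2 := by omega
  have h2' : (2 : ZMod ℓ) ≠ 0 := by exact_mod_cast natCast_prime_ne_zero_zmod Nat.prime_two h2
  have h4 : (4 : ZMod ℓ) ≠ 0 := by rw [show (4 : ZMod ℓ) = 2 * 2 by norm_num]; exact mul_ne_zero h2' h2'
  have hm1 : ¬ IsSquare (-1 : ZMod ℓ) := by rw [ZMod.exists_sq_eq_neg_one_iff]; omega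
  obtain ⟨r, hr⟩ := (ZMod.exists_sq_eq_two_iff h2).2 (Or.inr h8)
  have hne1 : ∀ t : ZMod ℓ, t ^ 2 = 1 → r ≠ t := by
    rintro t ht rfl; rw [← sq, ht] at hr; exact one_ne_zero (by linear_combination hr)
  have hr1 : r - 1 ≠ 0 := sub_ne_zero.2 (hne1 1 (one_pow 2))
  have hr1' : r + 1 ≠ 0 := fun h => hne1 (-1) (by ring) (by linear_combination h)
  refine mk_prime_mul_ne_splitDiscriminantClassCM_of_two_roots hR (by norm_num) (by norm_num) disc_not_sq_six_one
    ℓ hℓ (-3 + 2 * r) (-3 - 2 * r) (by push_cast; linear_combination (-4 : ZMod ℓ) * hr)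
    (by push_cast; linear_combination (-4 : ZMod ℓ) * hr) ?_ ?_ ?_ w hw u hu
  · intro h
    have hr0 : r = 0 := eq_zero_of_const_mul_eq_zero h4 (by linear_combination h)
    rw [hr0, mul_zero] at hr
    exact h2' hr
  · intro x hx
    exact forall_sq_ne_neg_sq hm1 (r - 1) hr1 x (by rw [hx]; linear_combination (-1 : ZMod ℓ) * hr)
  · intro x hx
    exact forall_sq_ne_neg_sq hm1 (r + 1) hr1' x (by rw [hx]; linear_combination (-1 : ZMod ℓ) * hr)

/-- **`[ℓ] ≠ [1]` for `E = ℚ(ζ₈)` and every prime `ℓ ≡ 7 (mod 8)`.** [cite: Deligne1982HodgeCycles, §4 p. 30 (1) and Cor. 4.2] -/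
theorem zeta8_mk_prime_ne_splitDiscriminantClassCM_of_mod_eight (ℓ : ℕ) (hℓ : ℓ.Prime) (h8 : ℓ % 8 = 7)
    (u : (realField R)ˣ) (hu : (u : realField R) = ℓ) :
    (QuotientGroup.mk u : cmNormResidueGroup R) ≠ splitDiscriminantClassCM R 2 :=
  zeta8_mk_prime_mul_ne_splitDiscriminantClassCM_of_mod_eight hR ℓ hℓ h8 1 (by exact_mod_cast hℓ.not_dvd_one) u
    (by rw [hu, Int.cast_one, mul_one]; exact (map_natCast (AdjoinRoot.of (realPolyQ R)) ℓ).symm)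

/-- **`[ℓ] = [1]` for `E = ℚ(ζ₈)` and EVERY prime `ℓ ≢ 3 (mod 4)`** (Fermat, Mathlib `Nat.Prime.sq_add_sq`: `ℓ = a² + b²
`= Nm_{E/F}(a + bi)`; in Deligne's coordinates `i = η/(1+√2)`, `√2 = -(σ+3)/2`: the witness
`(2a)² - σ(5b + bσ)² ∈ ℤ ⊕ ℤσ` has coordinates `(4ℓ, 0)`): the row `W8.E.[ℓ]` is the SPLIT component for all these
primes (census: `2, 5, 13, 17, 29, 37, …`). [cite: Deligne1982HodgeCycles, §4 p. 30 (1) and Cor. 4.2] -/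
theorem zeta8_mk_prime_eq_splitDiscriminantClassCM_of_mod_four (ℓ : ℕ) (hℓ : ℓ.Prime) (h4 : ℓ % 4 ≠ 3)
    (u : (realField R)ˣ) (hu : (u : realField R) = ℓ) :
    (QuotientGroup.mk u : cmNormResidueGroup R) = splitDiscriminantClassCM R 2 := by
  haveI : Fact ℓ.Prime := ⟨hℓ⟩
  obtain ⟨a, b, hab⟩ := Nat.Prime.sq_add_sq h4
  have habZ : ((a : ℤ)) ^ 2 + (b : ℤ) ^ 2 = ℓ := by exact_mod_cast hab
  exact mk_eq_splitDiscriminantClassCM_two_of_coords_of_pos hR (by norm_num) (by norm_num) disc_not_sq_six_one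
    ℓ (2 * a) 0 (5 * b) b 2 two_ne_zero (by linear_combination 4 * habZ) (by ring) u
    (by rw [hu]; push_cast; exact (map_natCast (AdjoinRoot.of (realPolyQ R)) ℓ).symm)

end Zeta8

end Summit.HodgeConjecture.HodgeConjecture.Ring2.WeilCoverageCM

end
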